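import Summits.Ventures.Crystal3D.Bulk.RotSysDelete
import Summits.Ventures.Crystal3D.Bulk.RotSysMerge
import HarnessLib

/-!
# Deleting one edge from a sub-rotation-system: the face count (generic brick (G1c), part (F),
# of `phase2/LEAN-FACES-DESIGN.md` §5.4)

HONEST FRAMING. Part of the venture `Summits/Ventures/Crystal3D` (cell `pub-crystal3d`, phase 2;
seat typer-bulk-2), PURELY COMBINATORIAL and generic (folklore). For a loopless rotation system
`(σ, α)`, an `α`-closed `S`, `d ∈ S`, `e = {d, α d}`, `S′ = S ∖ e`, `φ = phi σ α S`:

* `nu σ α S d := swap d (α d) * φ` and **`IsRotSys.phi_sdiff_eq_induce_nu`**: on `S′` the face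
  permutation of `S′` is the first-return map of `ν` to `S′` (the pointwise splice of
  `Bulk/RotSysDelete.lean` read through `ν`);
* `IsRotSys.numF_sdiff_eq`: `numF S′ = numClasses (SameCycle ν) S′`;
* `IsRotSys.numClasses_nu_sdiff`: `numClasses ν S′ + [φ (α d) = d] + [φ d = α d] = numClasses ν S`
  (the darts `d`, `α d` are fixed by `ν` exactly in the pendant cases);
* MERGE / SPLIT (`Bulk/RotSysSwap.lean`): `IsRotSys.numClasses_nu_merge`
  (`¬ SameCycle φ d (α d) ⇒ #ν-classes + 1 = numF S`), `IsRotSys.numClasses_nu_split`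
  (`SameCycle φ d (α d) ⇒ numF S + 1 = #ν-classes`);
* assembled: **`IsRotSys.numF_sdiff_merge`** (`numF S′ + 1 = numF S`, and then `φ d ≠ α d`,
  `φ (α d) ≠ d`) and **`IsRotSys.numF_sdiff_split`**
  (`numF S′ + [φ (α d) = d] + [φ d = α d] = numF S + 1`).

The vertex/component parts are in `RotSysDelete`/`RotSysDeleteK`; the final inequality
`chi2 (S∖e) − 4·numK (S∖e) ≥ chi2 S − 4·numK S` is NOT here (next file).
-/

namespace Summit.Ventures.Crystal3D

namespace RotSys

open Equiv Equiv.Perm Finset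

variable {D : Type*} [DecidableEq D] [Fintype D]

/-! ## Generic: class counts of pointwise-equal relations / permutations agreeing on a set -/

section Generic

open scoped Classical

omit [Fintype D] in
/-- Relations that agree on `S` have the same number of classes on `S`. -/
theorem numClasses_congr {R R' : D → D → Prop} {S : Finset D}
    (h : ∀ x ∈ S, ∀ y ∈ S, (R x y ↔ R' x y)) : numClasses R S = numClasses R' S := by
  unfold numClasses
  congr 1
  refine Finset.image_congr fun x hx => ?_
  rw [Finset.mem_coe] at hx
  ext y
  simp only [Finset.mem_filter]
  exact ⟨fun ⟨hy, hr⟩ => ⟨hy, (h x hx y hy).1 hr⟩, fun ⟨hy, hr⟩ => ⟨hy, (h x hx y hy).2 hr⟩⟩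

omit [DecidableEq D] [Fintype D] in
/-- Two permutations that agree on a set `T` mapped to itself by the first have the same powers
on `T`. -/
theorem pow_apply_eq_of_eqOn {f g : Perm D} {T : Finset D} (hfg : ∀ x ∈ T, f x = g x)
    (hf : ∀ x ∈ T, f x ∈ T) {x : D} (hx : x ∈ T) (n : ℕ) : (f ^ n) x = (g ^ n) x ∧ (f ^ n) x ∈ T := by
  induction n with
  | zero => simpa using hx
  | succ n ih =>
    obtain ⟨h1, h2⟩ := ih
    rw [pow_succ', Perm.mul_apply, pow_succ', Perm.mul_apply, ← h1, hfg _ h2]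
    exact ⟨rfl, by rw [← hfg _ h2]; exact hf _ h2⟩

omit [DecidableEq D] in
/-- Two permutations that agree on `T`, both mapping `T` to itself, have the same cycles through
points of `T`. -/
theorem sameCycle_iff_of_eqOn {f g : Perm D} {T : Finset D} (hfg : ∀ x ∈ T, f x = g x)
    (hf : ∀ x ∈ T, f x ∈ T) (hg : ∀ x ∈ T, g x ∈ T) {x : D} (hx : x ∈ T) (y : D) :
    f.SameCycle x y ↔ g.SameCycle x y := by
  constructor
  · intro h
    obtain ⟨n, hn⟩ := h.exists_nat_pow_eq
    rw [(pow_apply_eq_of_eqOn hfg hf hx n).1] at hn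
    exact ⟨n, by rw [zpow_natCast, hn]⟩
  · intro h
    obtain ⟨n, hn⟩ := h.exists_nat_pow_eq
    rw [(pow_apply_eq_of_eqOn (fun x hx => (hfg x hx).symm) hg hx n).1] at hn
    exact ⟨n, by rw [zpow_natCast, hn]⟩

omit [DecidableEq D] in
/-- A fixed point is alone on its cycle. -/
theorem eq_of_sameCycle_of_apply_eq {f : Perm D} {x y : D} (hfix : f x = x) (h : f.SameCycle x y) :
    y = x := by
  obtain ⟨n, hn⟩ := h.exists_nat_pow_eq
  have hpow : ∀ k : ℕ, (f ^ k) x = x := by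
    intro k
    induction k with
    | zero => simp
    | succ k ih => rw [pow_succ, Perm.mul_apply, hfix]; exact ih
  rw [← hn]
  exact hpow n

end Generic

/-! ## The auxiliary permutation `ν = swap d (α d) * φ` -/

/-- `ν := swap d (α d) * φ_S`. -/
noncomputable def nu (σ α : Perm D) (S : Finset D) (d : D) : Perm D :=
  swap d (α d) * phi σ α S

/-- Unfolding `nu`. -/
theorem nu_apply (σ α : Perm D) (S : Finset D) (d x : D) :
    nu σ α S d x = swap d (α d) (phi σ α S x) :=
  Perm.mul_apply _ _ _

variable {σ α : Perm D} {S : Finset D} {d : D}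

/-- `ν` maps `S` to `S` (for `α`-closed `S ∋ d`). -/
theorem nu_apply_mem (hS : IsClosed α S) (hd : d ∈ S) {x : D} (hx : x ∈ S) : nu σ α S d x ∈ S := by
  rw [nu_apply]
  have hφ := phi_apply_mem (σ := σ) hS hx
  rcases eq_or_ne (phi σ α S x) d with h | h
  · rw [h, swap_apply_left]; exact hS d hd
  rcases eq_or_ne (phi σ α S x) (α d) with h' | h'
  · rw [h', swap_apply_right]; exact hd
  · rw [swap_apply_of_ne_of_ne h h']; exact hφ

/-- **On `S ∖ e` the face permutation of `S ∖ e` is the first-return map of `ν`.** -/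
theorem IsRotSys.phi_sdiff_eq_induce_nu (h : IsRotSys σ α) (hS : IsClosed α S) (hd : d ∈ S)
    {x : D} (hx : x ∈ S \ {d, α d}) :
    phi σ α (S \ {d, α d}) x = induce (nu σ α S d) (S \ {d, α d}) x := by
  set S' := S \ {d, α d} with hS'
  have hsub : S' ⊆ S := Finset.sdiff_subset
  have hxS : x ∈ S := hsub hx
  have hαd : α d ∈ S := hS d hd
  have hne : α d ≠ d := h.α_ne d
  have mem_S' : ∀ z, z ∈ S' ↔ z ∈ S ∧ z ≠ d ∧ z ≠ α d := by
    intro z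
    rw [hS', Finset.mem_sdiff, Finset.mem_insert, Finset.mem_singleton, not_or]
  have hφx : phi σ α S x ∈ S := phi_apply_mem hS hxS
  rw [h.phi_sdiff_apply hS hd hx]
  symm
  split_ifs with h1 h2
  · -- `φ x = d`: `ν x = α d ∉ S'`, `ν (α d) = φ (α d) ∈ S'` — first return after two steps
    have hy : α x ∈ S := hS x hxS
    have hnd : induce σ S d ≠ d := by
      refine induce_ne_self_of_mem_cycle σ hd hy ?_ ?_
      · intro hαx
        exact ((mem_S' x).1 hx).2.2 (by rw [← hαx, h.α_inv])
      · have := sameCycle_induce_apply σ S (α x)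
        rw [← phi_apply, h1] at this
        exact this.symm
    have hφαd : phi σ α S (α d) ∈ S' := by
      rw [mem_S', phi_apply, h.α_inv]
      exact ⟨induce_apply_mem σ hd, hnd, h.induce_ne_alpha S d⟩
    refine induce_eq_of_first_return _ hx (n := 2) (by norm_num) ?_ hφαd ?_
    · rw [pow_two, Perm.mul_apply, nu_apply σ α S d x, h1, swap_apply_left, nu_apply]
      obtain ⟨-, h3, h4⟩ := (mem_S' _).1 hφαd
      exact swap_apply_of_ne_of_ne h3 h4
    · intro m hm0 hm2
      obtain rfl : m = 1 := by omega
      rw [pow_one, nu_apply, h1, swap_apply_left, mem_S']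
      tauto
  · -- `φ x = α d`: `ν x = d ∉ S'`, `ν d = φ d ∈ S'`
    have hy : α x ∈ S := hS x hxS
    have hnd : induce σ S (α d) ≠ α d := by
      refine induce_ne_self_of_mem_cycle σ hαd hy ?_ ?_
      · intro hαx
        exact ((mem_S' x).1 hx).2.1 (α.injective hαx)
      · have := sameCycle_induce_apply σ S (α x)
        rw [← phi_apply, h2] at this
        exact this.symm
    have hnd' : induce σ S (α d) ≠ d := by
      have := h.induce_ne_alpha S (α d)
      rwa [h.α_inv] at this
    have hφd : phi σ α S d ∈ S' := by
      rw [mem_S', phi_apply]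
      exact ⟨induce_apply_mem σ hαd, hnd', hnd⟩
    refine induce_eq_of_first_return _ hx (n := 2) (by norm_num) ?_ hφd ?_
    · rw [pow_two, Perm.mul_apply, nu_apply σ α S d x, h2, swap_apply_right, nu_apply]
      obtain ⟨-, h3, h4⟩ := (mem_S' _).1 hφd
      exact swap_apply_of_ne_of_ne h3 h4
    · intro m hm0 hm2
      obtain rfl : m = 1 := by omega
      rw [pow_one, nu_apply, h2, swap_apply_right, mem_S']
      tauto
  · -- generic: `ν x = φ x ∈ S'`
    have hmem : phi σ α S x ∈ S' := by rw [mem_S']; exact ⟨hφx, h1, h2⟩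
    refine induce_eq_of_first_return _ hx (n := 1) Nat.one_pos ?_ hmem ?_
    · rw [pow_one, nu_apply, swap_apply_of_ne_of_ne h1 h2]
    · intro m hm0 hm1; omega

/-- **The face count of `S ∖ e` is the number of `ν`-cycles meeting `S ∖ e`.** -/
theorem IsRotSys.numF_sdiff_eq (h : IsRotSys σ α) (hS : IsClosed α S) (hd : d ∈ S) :
    numF σ α (S \ {d, α d}) =
      numClasses (fun x y => (nu σ α S d).SameCycle x y) (S \ {d, α d}) := by
  unfold numF
  apply numClasses_congr
  intro x hx y hy
  have hS' : IsClosed α (S \ {d, α d}) := isClosed_sdiff_pair h hS d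
  -- `φ'` agrees with `induce ν S'` on `S'`, both preserve `S'`
  rw [sameCycle_iff_of_eqOn (fun z hz => h.phi_sdiff_eq_induce_nu hS hd hz)
    (fun z hz => phi_apply_mem hS' hz) (fun z hz => induce_apply_mem _ hz) hx y]
  exact sameCycle_induce_iff _ hx hy

/-- **Erasing `d` and `α d` from the `ν`-count**: they are fixed by `ν` exactly in the pendant
cases, so `numClasses ν (S ∖ e) + [φ (α d) = d] + [φ d = α d] = numClasses ν S`. -/
theorem IsRotSys.numClasses_nu_sdiff (h : IsRotSys σ α) (hS : IsClosed α S) (hd : d ∈ S) :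
    numClasses (fun x y => (nu σ α S d).SameCycle x y) (S \ {d, α d}) +
        (if phi σ α S (α d) = d then 1 else 0) + (if phi σ α S d = α d then 1 else 0) =
      numClasses (fun x y => (nu σ α S d).SameCycle x y) S := by
  classical
  set ν := nu σ α S d with hν
  have hαd : α d ∈ S := hS d hd
  have hne : α d ≠ d := h.α_ne d
  have hrefl : ∀ T : Finset D, ∀ x ∈ T, ν.SameCycle x x := fun _ x _ => SameCycle.refl ν x
  have hsymm : ∀ T : Finset D, ∀ x ∈ T, ∀ y ∈ T, ν.SameCycle x y → ν.SameCycle y x :=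
    fun _ _ _ _ _ h => h.symm
  have htrans : ∀ T : Finset D, ∀ x ∈ T, ∀ y ∈ T, ∀ z ∈ T,
      ν.SameCycle x y → ν.SameCycle y z → ν.SameCycle x z := fun _ _ _ _ _ _ _ h1 h2 => h1.trans h2
  -- step 1: erase `d`
  have s1 := numClasses_erase (R := fun x y => ν.SameCycle x y) (hrefl S) (hsymm S) (htrans S) hd
  -- `d` not alone ⟺ `ν d ≠ d` ⟺ `φ d ≠ α d`
  have hνd : ν d = d ↔ phi σ α S d = α d := by
    rw [hν, nu_apply]
    constructor
    · intro h1
      by_contra h2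
      rcases eq_or_ne (phi σ α S d) d with h3 | h3
      · exact h.phi_ne_self S d h3
      · rw [swap_apply_of_ne_of_ne h3 h2] at h1
        exact h3 h1
    · intro h1; rw [h1, swap_apply_right]
  have i1 : (∃ y ∈ S, y ≠ d ∧ ν.SameCycle d y) ↔ ¬ phi σ α S d = α d := by
    rw [← hνd]
    constructor
    · rintro ⟨y, -, hyd, hc⟩ hfix
      exact hyd (eq_of_sameCycle_of_apply_eq hfix hc)
    · intro hfix
      exact ⟨ν d, nu_apply_mem hS hd hd, hfix, ⟨1, by simp⟩⟩
  -- step 2: erase `α d` from `S.erase d`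
  have hαd' : α d ∈ S.erase d := Finset.mem_erase.2 ⟨hne, hαd⟩
  have s2 := numClasses_erase (R := fun x y => ν.SameCycle x y) (hrefl _) (hsymm _) (htrans _) hαd'
  have hνα : ν (α d) = α d ↔ phi σ α S (α d) = d := by
    rw [hν, nu_apply]
    constructor
    · intro h1
      by_contra h2
      rcases eq_or_ne (phi σ α S (α d)) (α d) with h3 | h3
      · exact h.phi_ne_self S (α d) h3
      · rw [swap_apply_of_ne_of_ne h2 h3] at h1
        exact h3 h1
    · intro h1; rw [h1, swap_apply_left]
  have i2 : (∃ y ∈ S.erase d, y ≠ α d ∧ ν.SameCycle (α d) y) ↔ ¬ phi σ α S (α d) = d := by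
    rw [← hνα]
    constructor
    · rintro ⟨y, -, hyd, hc⟩ hfix
      exact hyd (eq_of_sameCycle_of_apply_eq hfix hc)
    · intro hfix
      refine ⟨ν (α d), Finset.mem_erase.2 ⟨?_, nu_apply_mem hS hd hαd⟩, hfix, ⟨1, by simp⟩⟩
      -- `ν (α d) = d` would mean `φ (α d) = α d`
      intro hbad
      rw [hν, nu_apply] at hbad
      rcases eq_or_ne (phi σ α S (α d)) d with h3 | h3
      · rw [h3, swap_apply_left] at hbad; exact hne hbad
      rcases eq_or_ne (phi σ α S (α d)) (α d) with h4 | h4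
      · exact h.phi_ne_self S (α d) h4
      · rw [swap_apply_of_ne_of_ne h3 h4] at hbad; exact h3 hbad
  rw [sdiff_pair_eq_erase_erase]
  by_cases ha : phi σ α S d = α d <;> by_cases hb : phi σ α S (α d) = d
  · rw [if_neg (fun hh => (i1.1 hh) ha)] at s1
    rw [if_neg (fun hh => (i2.1 hh) hb)] at s2
    rw [if_pos hb, if_pos ha]; omega
  · rw [if_neg (fun hh => (i1.1 hh) ha)] at s1
    rw [if_pos (i2.2 hb)] at s2
    rw [if_neg hb, if_pos ha]; omega
  · rw [if_pos (i1.2 ha)] at s1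
    rw [if_neg (fun hh => (i2.1 hh) hb)] at s2
    rw [if_pos hb, if_neg ha]; omega
  · rw [if_pos (i1.2 ha)] at s1
    rw [if_pos (i2.2 hb)] at s2
    rw [if_neg hb, if_neg ha]; omega

/-- MERGE: if `d, α d` are on different faces of `S`, `#ν-classes + 1 = numF S`. -/
theorem IsRotSys.numClasses_nu_merge (h : IsRotSys σ α) (hS : IsClosed α S) (hd : d ∈ S)
    (hdiff : ¬ (phi σ α S).SameCycle d (α d)) :
    numClasses (fun x y => (nu σ α S d).SameCycle x y) S + 1 = numF σ α S := by
  have _ := h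
  exact numClasses_sameCycle_swap_mul_add_one (phi σ α S) hd (hS d hd) hdiff

/-- SPLIT: if `d, α d` are on the same face of `S`, `numF S + 1 = #ν-classes`. -/
theorem IsRotSys.numClasses_nu_split (h : IsRotSys σ α) (hS : IsClosed α S) (hd : d ∈ S)
    (hsame : (phi σ α S).SameCycle d (α d)) :
    numF σ α S + 1 = numClasses (fun x y => (nu σ α S d).SameCycle x y) S := by
  have hne : d ≠ α d := (h.α_ne d).symm
  have hdiff := not_sameCycle_swap_mul_of_sameCycle (phi σ α S) hne hsame
  have key := numClasses_sameCycle_swap_mul_add_one (nu σ α S d) hd (hS d hd) hdiff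
  have e : swap d (α d) * nu σ α S d = phi σ α S := by
    rw [nu, ← mul_assoc, swap_mul_self, one_mul]
  rw [e] at key
  exact key

/-- **(F), MERGE case**: `numF (S ∖ e) + 1 = numF S`, and neither end of `e` is pendant. -/
theorem IsRotSys.numF_sdiff_merge (h : IsRotSys σ α) (hS : IsClosed α S) (hd : d ∈ S)
    (hdiff : ¬ (phi σ α S).SameCycle d (α d)) :
    numF σ α (S \ {d, α d}) + 1 = numF σ α S ∧ phi σ α S d ≠ α d ∧ phi σ α S (α d) ≠ d := by
  have ha : phi σ α S d ≠ α d := fun he => hdiff ⟨1, by simp [he]⟩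
  have hb : phi σ α S (α d) ≠ d := fun he => hdiff (SameCycle.symm ⟨1, by simp [he]⟩)
  refine ⟨?_, ha, hb⟩
  have h1 := h.numF_sdiff_eq hS hd
  have h2 := h.numClasses_nu_sdiff hS hd
  have h3 := h.numClasses_nu_merge hS hd hdiff
  rw [if_neg hb, if_neg ha] at h2
  omega

/-- **(F), SPLIT case**: `numF (S ∖ e) + [φ (α d) = d] + [φ d = α d] = numF S + 1`. -/
theorem IsRotSys.numF_sdiff_split (h : IsRotSys σ α) (hS : IsClosed α S) (hd : d ∈ S)
    (hsame : (phi σ α S).SameCycle d (α d)) :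
    numF σ α (S \ {d, α d}) + (if phi σ α S (α d) = d then 1 else 0) +
        (if phi σ α S d = α d then 1 else 0) = numF σ α S + 1 := by
  have h1 := h.numF_sdiff_eq hS hd
  have h2 := h.numClasses_nu_sdiff hS hd
  have h3 := h.numClasses_nu_split hS hd hsame
  omega

end RotSys

end Summit.Ventures.Crystal3D
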